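import Summits.QuantumAdvantage.QuantumAdvantage.Theorems.HolonomyDialPlant

/-!
# HolonomyDial — Decode (cell decomp-qadv, seat lens-2, generation 13; supports item 26531 `ExactnessDial.PolyLossOddU3`)

§K second half: `plant_comp_mem`, `good_le`, `deg_choose_le`, `holDecode_hard`, `card_odd_le`, `exists_split`, `holDecode_hard_polylog`, **`holDecodeLoss3 : HolDecodeLoss3`**, `holDecodePerfect3`.

Split (≤ 400 lines, part 4/11) of the node file `HOME/decomp-qadv-lens-2/g13/HolonomyDial.lean` (v5, sha256 fb2c0281…,
farm rc 0, no placeholders); declarations verbatim, namespace `Summit.QuantumAdvantage.QuantumAdvantage.Theorems.HolonomyDial`.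
Record: NODE-g13.md.
-/

set_option linter.dupNamespace false

noncomputable section
open scoped Classical

namespace Summit.QuantumAdvantage.QuantumAdvantage.Theorems

open Finset
open Literature.Computability.QuantumComplexity Literature.Computability.QuantumComplexity.RingHLF
open Literature.Computability.MetaComplexity Literature.Computability.MetaComplexity.Smolensky
open Summit.QuantumAdvantage.AdviceFreeQNC0
open Summit.QuantumAdvantage.QuantumAdvantage.Theses (ExactnessDial.PolyLossOddU3 ExactnessDial.NoPerfectOdd3
  ExactnessDial.NoPerfectConst3 ExactnessDial.MassStep3u ExactnessDial.OddToAll3 ExactnessDial.DPLift3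
  ExactnessDial.MultiRingBridge3 ExactnessDial.closes)

namespace HolonomyDial

section Decoding

variable {m t : ℕ}

/-! ### the decoder restricted to a planting is a low-degree polynomial in `w` -/

/-- Ring-game helper `plant_comp_mem` (lens-2 law package; see the module docstring). -/
theorem plant_comp_mem (μ : Fin 3 → Bool) (r r' : Fin m → Bool) (ctx : Fin t → Bool) {D : ℕ}
    {V : CubeFn (ZMod 3) (m + 3 + m + t)} (hV : V ∈ lowDeg (ZMod 3) (m + 3 + m + t) D) :
    (fun w => V (plant μ w r r' ctx)) ∈ lowDeg (ZMod 3) m D := by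
  refine Smolensky.comp_mem_lowDeg_of_coord (F := ZMod 3) (fun w => plant μ w r r' ctx) (fun j => ?_) hV
  have xorInd : ∀ (i : Fin m) (b : Bool),
      (fun u : Fin m → Bool => if xor (u i) b = true then (1 : ZMod 3) else 0) ∈ lowDeg (ZMod 3) m 1 := by
    intro i b
    cases b
    · have : (fun u : Fin m → Bool => if xor (u i) false = true then (1 : ZMod 3) else 0) = mono (ZMod 3) {i} := by
        funext u; rw [mono_singleton_apply]; cases u i <;> rfl
      rw [this]; exact mono_mem_lowDeg (by simp)
    · have : (fun u : Fin m → Bool => if xor (u i) true = true then (1 : ZMod 3) else 0) = 1 - mono (ZMod 3) {i} := by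
        funext u; rw [Pi.sub_apply, Pi.one_apply, mono_singleton_apply]; cases u i <;> simp
      rw [this]; exact Submodule.sub_mem _ (one_mem_lowDeg 1) (mono_mem_lowDeg (by simp))
  have constInd : ∀ b : Bool, (fun _ : Fin m → Bool => if b = true then (1 : ZMod 3) else 0) ∈ lowDeg (ZMod 3) m 1 := by
    intro b; cases b
    · have : (fun _ : Fin m → Bool => if false = true then (1 : ZMod 3) else 0) = 0 := by funext u; simp
      rw [this]; exact Submodule.zero_mem _
    · have : (fun _ : Fin m → Bool => if true = true then (1 : ZMod 3) else 0) = 1 := by funext u; simp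
      rw [this]; exact one_mem_lowDeg 1
  by_cases h1 : j.val < m
  · have e : (fun u : Fin m → Bool => if plant μ u r r' ctx j = true then (1 : ZMod 3) else 0) =
        fun u => if xor (u ⟨j.val, h1⟩) (r ⟨j.val, h1⟩) = true then (1 : ZMod 3) else 0 := by
      funext u; rw [plant_apply_lt μ u r r' ctx j h1]
    rw [e]; exact xorInd _ _
  by_cases h2 : j.val < m + 3
  · have e : (fun u : Fin m → Bool => if plant μ u r r' ctx j = true then (1 : ZMod 3) else 0) =
        fun _ => if μ ⟨j.val - m, by omega⟩ = true then (1 : ZMod 3) else 0 := by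
      funext u; rw [plant_apply_mid μ u r r' ctx j h1 h2]
    rw [e]; exact constInd _
  by_cases h3 : j.val < m + 3 + m
  · have e : (fun u : Fin m → Bool => if plant μ u r r' ctx j = true then (1 : ZMod 3) else 0) =
        fun u => if xor (u ⟨j.val - (m + 3), by omega⟩) (r' ⟨j.val - (m + 3), by omega⟩) = true then (1 : ZMod 3) else 0 := by
      funext u; rw [plant_apply_win2 μ u r r' ctx j h2 h3]
    rw [e]; exact xorInd _ _
  · have e : (fun u : Fin m → Bool => if plant μ u r r' ctx j = true then (1 : ZMod 3) else 0) =
        fun _ => if ctx ⟨j.val - (m + 3 + m), by have := j.isLt; omega⟩ = true then (1 : ZMod 3) else 0 := by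
      funext u; rw [plant_apply_ctx μ u r r' ctx j h3]
    rw [e]; exact constInd _

/-- `χ(r)² = 1` for the order-2 character over `𝔽₃`. -/
theorem omMono_two_sq {k : ℕ} (r : Fin k → Bool) :
    omMono (2 : ZMod 3) univ r * omMono (2 : ZMod 3) univ r = 1 := by
  rw [omMono_univ_apply, ← mul_pow, show (2 : ZMod 3) * 2 = 1 by decide, one_pow]

/-- **Smolensky step**: for fixed masks, the `w`'s on which BOTH planted decodings are correct are at most
`2^{m-1} + D·C(m, ⌊m/2⌋)` — two correct decodings produce the character `χ(w)` by a degree-`D` polynomial. -/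
theorem good_le (hm : Odd m) (r r' : Fin m → Bool) (ctx : Fin t → Bool) {D : ℕ}
    {V : CubeFn (ZMod 3) (m + 3 + m + t)} (hV : V ∈ lowDeg (ZMod 3) (m + 3 + m + t) D) (κ : Bool) :
    (univ.filter fun w : Fin m → Bool =>
        V (xA w r r' ctx κ) = ((hol (xA w r r' ctx κ) : ℕ) : ZMod 3) ∧
        V (xB w r r' ctx κ) = ((hol (xB w r r' ctx κ) : ℕ) : ZMod 3)).card ≤ 2 ^ (m - 1) + D * m.choose (m / 2) := by
  have hm1 : 1 ≤ m := by obtain ⟨k, rfl⟩ := hm; omega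
  set s : ZMod 3 := (-1) ^ m * omMono (2 : ZMod 3) univ r with hs
  set G : CubeFn (ZMod 3) m := fun w => s * (V (xA w r r' ctx κ) - V (xB w r r' ctx κ)) with hG
  have hGmem : G ∈ lowDeg (ZMod 3) m D := by
    have h1 := plant_comp_mem (muA κ) r r' ctx hV
    have h2 := plant_comp_mem (muB κ) r r' ctx hV
    have e : G = s • ((fun w => V (plant (muA κ) w r r' ctx)) - fun w => V (plant (muB κ) w r r' ctx)) := by
      funext w; simp only [hG, xA, xB, Pi.smul_apply, Pi.sub_apply, smul_eq_mul]
    rw [e]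
    exact Submodule.smul_mem _ _ (Submodule.sub_mem _ h1 h2)
  have hS : (univ.filter fun w : Fin m → Bool => omMono (2 : ZMod 3) univ w = G w).card ≤
      2 ^ (m - 1) + D * m.choose (m / 2) := by
    convert card_filter_omMono_eq_le hm (ω := (2 : ZMod 3)) (by decide) (by decide) hGmem
  refine le_trans (card_le_card fun w hw => ?_) hS
  rw [mem_filter] at hw ⊢
  refine ⟨mem_univ _, ?_⟩
  obtain ⟨-, ha, hb⟩ := hw
  have hdiff := hol_pair w r r' ctx hm1 κ
  rw [← ha, ← hb] at hdiff
  have hsign : (if zpar (xA w r r' ctx κ) m then (-1 : ZMod 3) else 1) =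
      (-1) ^ m * omMono (2 : ZMod 3) univ r * omMono (2 : ZMod 3) univ w := zpar_plant_sign (muA κ) w r r' ctx
  rw [hsign] at hdiff
  show omMono 2 univ w = s * (V (xA w r r' ctx κ) - V (xB w r r' ctx κ))
  rw [hdiff, hs]
  have hsq := omMono_two_sq r
  have hnn : ((-1 : ZMod 3) ^ m) * ((-1 : ZMod 3) ^ m) = 1 := by
    rw [← pow_add]; exact Even.neg_one_pow ⟨m, rfl⟩
  linear_combination (-(omMono (2 : ZMod 3) univ w)) * ((-1 : ZMod 3) ^ m * (-1) ^ m) * hsq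
    - (omMono (2 : ZMod 3) univ w) * hnn

/-! ### averaging over the masks -/

/-- the middle-coefficient arithmetic: `16 D² ≤ m` (odd) gives `D·C(m, ⌊m/2⌋) ≤ 2^{m-2}`. -/
theorem deg_choose_le (hm : Odd m) {D : ℕ} (hD : 16 * D ^ 2 ≤ m) : D * m.choose (m / 2) ≤ 2 ^ (m - 2) := by
  have hm1 : 1 ≤ m := by obtain ⟨k, rfl⟩ := hm; omega
  have hC := choose_half_sq_mul_le hm
  have h1 : (4 * (D * m.choose (m / 2))) ^ 2 ≤ (2 ^ m) ^ 2 := by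
    calc (4 * (D * m.choose (m / 2))) ^ 2 = 16 * D ^ 2 * m.choose (m / 2) ^ 2 := by ring
      _ ≤ m * m.choose (m / 2) ^ 2 := Nat.mul_le_mul_right _ hD
      _ = m.choose (m / 2) ^ 2 * m := by ring
      _ ≤ 4 ^ m := hC
      _ = (2 ^ m) ^ 2 := by rw [← pow_mul, mul_comm, pow_mul]; norm_num
  have h2 : 4 * (D * m.choose (m / 2)) ≤ 2 ^ m := (Nat.pow_le_pow_iff_left (by norm_num)).mp h1
  rcases Nat.lt_or_ge m 2 with hlt | hge
  · -- m = 1: then D = 0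
    have hm' : m = 1 := by omega
    subst hm'
    have : D = 0 := by nlinarith
    subst this; simp
  · obtain ⟨k, rfl⟩ : ∃ k, m = k + 2 := ⟨m - 2, by omega⟩
    rw [Nat.add_sub_cancel]
    rw [pow_add] at h2
    omega

/-- **THEOREM (holonomy decoding is parity-hard).**  For `N = m + 3 + m + t` with `m` odd and `16·D² ≤ m`, every
`𝔽₃`-polynomial `V` of degree `≤ D` fails to decode the holonomy trit on at least `2^{N-3}/8 = 2^{N-6}` patterns of the
odd class:  `2^{m+m+t} ≤ 8 · #{x : OddZeros x ∧ V x ≠ hol x}`. -/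
theorem holDecode_hard {N : ℕ} (hN : N = m + 3 + m + t) (hm : Odd m) (hm3 : 3 ≤ m) {D : ℕ} (hD : 16 * D ^ 2 ≤ m)
    {V : CubeFn (ZMod 3) N} (hV : V ∈ lowDeg (ZMod 3) N D) :
    2 ^ (m + m + t) ≤ 8 * (univ.filter fun x : Fin N → Bool => OddZeros x ∧ V x ≠ ((hol x : ℕ) : ZMod 3)).card := by
  subst hN
  have hm1 : 1 ≤ m := by omega
  -- the class bit of the masks
  let kap : (Fin m → Bool) × (Fin m → Bool) × (Fin t → Bool) → Bool := fun ρ =>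
    if OddZeros (xA ρ.1 ρ.1 ρ.2.1 ρ.2.2 false) then false else true
  have hoddA : ∀ (w : Fin m → Bool) (ρ : (Fin m → Bool) × (Fin m → Bool) × (Fin t → Bool)),
      OddZeros (xA w ρ.1 ρ.2.1 ρ.2.2 (kap ρ)) := by
    intro w ρ
    by_cases h : OddZeros (xA ρ.1 ρ.1 ρ.2.1 ρ.2.2 false)
    · have hk : kap ρ = false := by simp [kap, h]
      rw [hk]
      exact (odd_plant_indep (muA false) w ρ.1 ρ.2.1 ρ.2.2 ρ.1).2 h
    · have hk : kap ρ = true := by simp [kap, h]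
      rw [hk, odd_xA_flip]
      exact fun h' => h ((odd_plant_indep (muA false) w ρ.1 ρ.2.1 ρ.2.2 ρ.1).1 h')
  have hoddB : ∀ (w : Fin m → Bool) (ρ : (Fin m → Bool) × (Fin m → Bool) × (Fin t → Bool)),
      OddZeros (xB w ρ.1 ρ.2.1 ρ.2.2 (kap ρ)) := fun w ρ => (odd_xB_iff w ρ.1 ρ.2.1 ρ.2.2 (kap ρ)).2 (hoddA w ρ)
  -- the events
  set Bad := univ.filter fun x : Fin (m + 3 + m + t) → Bool => OddZeros x ∧ V x ≠ ((hol x : ℕ) : ZMod 3) with hBad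
  let GA : (Fin m → Bool) → ((Fin m → Bool) × (Fin m → Bool) × (Fin t → Bool)) → Prop := fun w ρ =>
    V (xA w ρ.1 ρ.2.1 ρ.2.2 (kap ρ)) = ((hol (xA w ρ.1 ρ.2.1 ρ.2.2 (kap ρ)) : ℕ) : ZMod 3)
  let GB : (Fin m → Bool) → ((Fin m → Bool) × (Fin m → Bool) × (Fin t → Bool)) → Prop := fun w ρ =>
    V (xB w ρ.1 ρ.2.1 ρ.2.2 (kap ρ)) = ((hol (xB w ρ.1 ρ.2.1 ρ.2.2 (kap ρ)) : ℕ) : ZMod 3)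
  -- (1) per ρ, few w are good for both
  have h1 : ∀ ρ : (Fin m → Bool) × (Fin m → Bool) × (Fin t → Bool),
      (univ.filter fun w => GA w ρ ∧ GB w ρ).card ≤ 2 ^ (m - 1) + 2 ^ (m - 2) := by
    intro ρ
    exact le_trans (good_le hm ρ.1 ρ.2.1 ρ.2.2 hV (kap ρ)) (Nat.add_le_add_left (deg_choose_le hm hD) _)
  -- (2) per w, the bad ρ inject into Bad
  have h2A : ∀ w : Fin m → Bool, (univ.filter fun ρ => ¬ GA w ρ).card ≤ Bad.card := by
    intro w
    refine Finset.card_le_card_of_injOn (fun ρ => xA w ρ.1 ρ.2.1 ρ.2.2 (kap ρ)) ?_ ?_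
    · intro ρ hρ
      rw [Finset.mem_coe, mem_filter] at hρ
      rw [hBad, Finset.mem_coe, mem_filter]
      exact ⟨mem_univ _, hoddA w ρ, hρ.2⟩
    · intro ρ₁ _ ρ₂ _ h
      obtain ⟨e1, e2, e3⟩ := plant_inj w h
      exact Prod.ext e1 (Prod.ext e2 e3)
  have h2B : ∀ w : Fin m → Bool, (univ.filter fun ρ => ¬ GB w ρ).card ≤ Bad.card := by
    intro w
    refine Finset.card_le_card_of_injOn (fun ρ => xB w ρ.1 ρ.2.1 ρ.2.2 (kap ρ)) ?_ ?_
    · intro ρ hρ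
      rw [Finset.mem_coe, mem_filter] at hρ
      rw [hBad, Finset.mem_coe, mem_filter]
      exact ⟨mem_univ _, hoddB w ρ, hρ.2⟩
    · intro ρ₁ _ ρ₂ _ h
      obtain ⟨e1, e2, e3⟩ := plant_inj w h
      exact Prod.ext e1 (Prod.ext e2 e3)
  -- (3) double counting over W × Rho
  have hR : Fintype.card ((Fin m → Bool) × (Fin m → Bool) × (Fin t → Bool)) = 2 ^ m * (2 ^ m * 2 ^ t) := by
    simp [Fintype.card_prod, Fintype.card_bool, Fintype.card_fin]
  have hW : Fintype.card (Fin m → Bool) = 2 ^ m := by simp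
  -- per ρ: every w is good-good, A-bad or B-bad
  have step : ∀ ρ : (Fin m → Bool) × (Fin m → Bool) × (Fin t → Bool),
      2 ^ m ≤ (2 ^ (m - 1) + 2 ^ (m - 2)) + (univ.filter fun w => ¬ GA w ρ).card + (univ.filter fun w => ¬ GB w ρ).card := by
    intro ρ
    have htot := Finset.card_filter_add_card_filter_not (s := (univ : Finset (Fin m → Bool))) (fun w => GA w ρ ∧ GB w ρ)
    rw [card_univ, hW] at htot
    have hsub : (univ.filter fun w => ¬ (GA w ρ ∧ GB w ρ)).card ≤
        (univ.filter fun w => ¬ GA w ρ).card + (univ.filter fun w => ¬ GB w ρ).card := by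
      refine le_trans (card_le_card fun w hw => ?_) (card_union_le _ _)
      rw [mem_filter] at hw
      rw [mem_union, mem_filter, mem_filter]
      by_cases ha : GA w ρ
      · exact Or.inr ⟨mem_univ _, fun hb => hw.2 ⟨ha, hb⟩⟩
      · exact Or.inl ⟨mem_univ _, ha⟩
    have := h1 ρ
    omega
  -- sum over ρ
  have hsum := Finset.sum_le_sum fun ρ (_ : ρ ∈ (univ : Finset ((Fin m → Bool) × (Fin m → Bool) × (Fin t → Bool)))) => step ρ
  rw [Finset.sum_const, Finset.card_univ, smul_eq_mul, Finset.sum_add_distrib, Finset.sum_add_distrib, Finset.sum_const,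
    Finset.card_univ, smul_eq_mul] at hsum
  -- exchange the order of summation and inject into Bad
  have exA : ∑ ρ : (Fin m → Bool) × (Fin m → Bool) × (Fin t → Bool), (univ.filter fun w => ¬ GA w ρ).card =
      ∑ w : Fin m → Bool, (univ.filter fun ρ : (Fin m → Bool) × (Fin m → Bool) × (Fin t → Bool) => ¬ GA w ρ).card := by
    simp_rw [Finset.card_filter]
    exact Finset.sum_comm
  have exB : ∑ ρ : (Fin m → Bool) × (Fin m → Bool) × (Fin t → Bool), (univ.filter fun w => ¬ GB w ρ).card =
      ∑ w : Fin m → Bool, (univ.filter fun ρ : (Fin m → Bool) × (Fin m → Bool) × (Fin t → Bool) => ¬ GB w ρ).card := by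
    simp_rw [Finset.card_filter]
    exact Finset.sum_comm
  have bA : ∑ w : Fin m → Bool, (univ.filter fun ρ : (Fin m → Bool) × (Fin m → Bool) × (Fin t → Bool) => ¬ GA w ρ).card ≤
      2 ^ m * Bad.card := by
    refine le_trans (Finset.sum_le_sum fun w _ => h2A w) ?_
    rw [Finset.sum_const, Finset.card_univ, smul_eq_mul, hW]
  have bB : ∑ w : Fin m → Bool, (univ.filter fun ρ : (Fin m → Bool) × (Fin m → Bool) × (Fin t → Bool) => ¬ GB w ρ).card ≤
      2 ^ m * Bad.card := by
    refine le_trans (Finset.sum_le_sum fun w _ => h2B w) ?_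
    rw [Finset.sum_const, Finset.card_univ, smul_eq_mul, hW]
  rw [exA] at hsum
  rw [exB] at hsum
  rw [hR] at hsum
  -- arithmetic with X = 2^(m-2)
  obtain ⟨k, rfl⟩ : ∃ k, m = k + 2 := ⟨m - 2, by omega⟩
  simp only [Nat.add_sub_cancel, show k + 2 - 1 = k + 1 from rfl] at hsum
  have e1 : 2 ^ (k + 2) = 4 * 2 ^ k := by ring
  have e2 : 2 ^ (k + 1) = 2 * 2 ^ k := by ring
  rw [e1, e2] at hsum
  rw [e1] at bA bB
  have hpos : 0 < 2 ^ k := Nat.two_pow_pos k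
  have epow : 2 ^ (k + 2 + (k + 2) + t) = 4 * 2 ^ k * (4 * 2 ^ k) * 2 ^ t := by
    rw [pow_add, pow_add, e1]
  rw [epow]
  set X := 2 ^ k with hX
  set B := Bad.card with hB
  set T := 2 ^ t with hT
  have key : X * (4 * X * (4 * X) * T) ≤ X * (8 * B) := by nlinarith
  exact Nat.le_of_mul_le_mul_left key hpos

/-! ### the asymptotic packaging -/

/-- the odd class has at most `2^{n-1}` patterns (`n ≥ 3`; chart lemma `card_odd_filter_le`). -/
theorem card_odd_le {n : ℕ} (hn : 3 ≤ n) :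
    (univ.filter fun x : Fin n → Bool => OddZeros x).card ≤ 2 ^ (n - 1) := by
  obtain ⟨k, rfl⟩ : ∃ k, n = k + 1 := ⟨n - 1, by omega⟩
  rw [Nat.add_sub_cancel]
  have h := card_odd_filter_le (n := k) (by omega) (fun _ => True)
  have e : (univ.filter fun x : Fin (k + 1) → Bool => OddZeros x) =
      univ.filter fun x : Fin (k + 1) → Bool =>
        (univ.filter fun j : Fin (k + 1) => x j = false).card % 2 = 1 ∧ (fun _ => True) (uVec x) := by
    ext x; simp [OddZeros]
  rw [e]
  refine le_trans h ?_
  simp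

/-- parameter choice: for large `n`, `n = m + 3 + m + t` with `m` odd, `m ≥ 3` and `16 (log₂ n)^{2c} ≤ m`. -/
theorem exists_split (c : ℕ) : ∃ n₀ : ℕ, ∀ n ≥ n₀, ∃ m t : ℕ, n = m + 3 + m + t ∧ Odd m ∧ 3 ≤ m ∧
    16 * ((Nat.log 2 n) ^ c) ^ 2 ≤ m ∧ 64 ≤ n := by
  obtain ⟨n₁, hn₁⟩ := TubePlanProof.logPow_le_natSqrt (2 * c + 1)
  refine ⟨max n₁ (2 ^ 64), fun n hn => ?_⟩
  have hn1 : n₁ ≤ n := le_trans (le_max_left _ _) hn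
  have hn64 : 2 ^ 64 ≤ n := le_trans (le_max_right _ _) hn
  have hL : 64 ≤ Nat.log 2 n := Nat.le_log_of_pow_le (by norm_num) hn64
  have h64n : 64 ≤ n := le_trans (by norm_num) hn64
  set q := (n - 5) / 4 with hq
  refine ⟨2 * q + 1, n - (4 * q + 5), by omega, ⟨q, by ring⟩, by omega, ?_, h64n⟩
  have hs := hn₁ n hn1
  have hsq : Nat.sqrt n ≤ n := Nat.sqrt_le_self n
  have hpow : 64 * ((Nat.log 2 n) ^ c) ^ 2 ≤ (Nat.log 2 n) ^ (2 * c + 1) := by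
    rw [← pow_mul, mul_comm c 2, pow_succ]
    calc 64 * Nat.log 2 n ^ (2 * c) ≤ Nat.log 2 n * Nat.log 2 n ^ (2 * c) := Nat.mul_le_mul_right _ hL
      _ = _ := mul_comm _ _
  omega

/-- **COROLLARY**: for every `c`, for all large `n`, every degree-`(log₂ n)^c` polynomial misreads the holonomy on
at least `2^{n-6}` odd patterns. -/
theorem holDecode_hard_polylog (c : ℕ) : ∃ n₀ : ℕ, ∀ n ≥ n₀, ∀ V : CubeFn (ZMod 3) n,
    V ∈ lowDeg (ZMod 3) n ((Nat.log 2 n) ^ c) →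
      2 ^ (n - 3) ≤ 8 * (univ.filter fun x : Fin n → Bool => OddZeros x ∧ V x ≠ ((hol x : ℕ) : ZMod 3)).card ∧ 64 ≤ n := by
  obtain ⟨n₀, hn₀⟩ := exists_split c
  refine ⟨n₀, fun n hn V hV => ?_⟩
  obtain ⟨m, t, hnt, hm, hm3, hD, h64⟩ := hn₀ n hn
  have h := holDecode_hard hnt hm hm3 hD hV
  have e : n - 3 = m + m + t := by omega
  rw [e]
  exact ⟨h, h64⟩

/-- **rung `HolDecodeLoss3` PROVED** (exponent `C = 1`; in fact constant loss `2^{-5}`). -/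
theorem holDecodeLoss3 : HolDecodeLoss3 := by
  refine ⟨1, fun c => ?_⟩
  obtain ⟨n₀, hn₀⟩ := holDecode_hard_polylog c
  refine ⟨n₀, fun n hn V hV => ?_⟩
  obtain ⟨h, h64⟩ := hn₀ n hn V hV
  have hodd := card_odd_le (n := n) (by omega)
  have hsplit : (univ.filter fun x : Fin n → Bool => OddZeros x ∧ V x = ((hol x : ℕ) : ZMod 3)).card +
      (univ.filter fun x : Fin n → Bool => OddZeros x ∧ V x ≠ ((hol x : ℕ) : ZMod 3)).card ≤
      (univ.filter fun x : Fin n → Bool => OddZeros x).card := by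
    rw [← Finset.card_union_of_disjoint (Finset.disjoint_filter.2 fun x _ h1 h2 => h2.2 h1.2)]
    refine card_le_card fun x hx => ?_
    rw [mem_union, mem_filter, mem_filter] at hx
    rw [mem_filter]
    rcases hx with h | h
    · exact ⟨h.1, h.2.1⟩
    · exact ⟨h.1, h.2.1⟩
  have e3 : 2 ^ (n - 1) = 4 * 2 ^ (n - 3) := by
    obtain ⟨k, rfl⟩ : ∃ k, n = k + 3 := ⟨n - 3, by omega⟩
    rw [Nat.add_sub_cancel, show k + 3 - 1 = k + 2 from rfl]; ring
  -- in ℕ: 8·agree + 2^(n-3) ≤ 8·2^(n-1)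
  have hnat : 8 * (univ.filter fun x : Fin n → Bool => OddZeros x ∧ V x = ((hol x : ℕ) : ZMod 3)).card + 2 ^ (n - 3) ≤
      8 * 2 ^ (n - 1) := by omega
  have hreal : (8 : ℝ) * ((univ.filter fun x : Fin n → Bool => OddZeros x ∧ V x = ((hol x : ℕ) : ZMod 3)).card : ℝ) +
      (2 : ℝ) ^ (n - 3) ≤ 8 * (2 : ℝ) ^ (n - 1) := by exact_mod_cast hnat
  have e3r : (2 : ℝ) ^ (n - 1) = 4 * (2 : ℝ) ^ (n - 3) := by exact_mod_cast e3
  rw [pow_one]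
  have hn' : (1 : ℝ) / (n : ℝ) ≤ 1 / 64 := by
    apply one_div_le_one_div_of_le (by norm_num)
    exact_mod_cast h64
  have hpos : (0 : ℝ) ≤ (2 : ℝ) ^ (n - 3) := by positivity
  have hmul := mul_le_mul_of_nonneg_right hn' hpos
  rw [e3r]
  nlinarith

/-! ### exact grade (aside) -/

/-- **aside `HolDecodePerfect3` PROVED** (the degree-`d` decoder fails once `16 d² ≤ m`). -/
theorem holDecodePerfect3 : HolDecodePerfect3 := by
  intro d
  obtain ⟨n₀, hn₀⟩ := exists_split 1
  refine ⟨max n₀ (2 ^ d), fun n hn V hV => ?_⟩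
  obtain ⟨m, t, hnt, hm, hm3, hlog, h64⟩ := hn₀ n (le_trans (le_max_left _ _) hn)
  have hbig : 2 ^ d ≤ n := le_trans (le_max_right _ _) hn
  have hd : d ≤ Nat.log 2 n := Nat.le_log_of_pow_le (by norm_num) hbig
  have hD : 16 * d ^ 2 ≤ m := by
    rw [pow_one] at hlog
    exact le_trans (Nat.mul_le_mul_left 16 (Nat.pow_le_pow_left hd 2)) hlog
  have h := holDecode_hard hnt hm hm3 hD hV
  have hpos : 0 < (univ.filter fun x : Fin n → Bool => OddZeros x ∧ V x ≠ ((hol x : ℕ) : ZMod 3)).card := by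
    have : 0 < 2 ^ (m + m + t) := Nat.two_pow_pos _
    omega
  obtain ⟨x, hx⟩ := Finset.card_pos.mp hpos
  rw [mem_filter] at hx
  exact ⟨x, hx.2.1, hx.2.2⟩

end Decoding

end HolonomyDial

end Summit.QuantumAdvantage.QuantumAdvantage.Theorems
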